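import Mathlib
import Summits.BirchSwinnertonDyer.BirchSwinnertonDyer.Theorems.ResidualThetaTransportAtTwoSignedMuSeedAtTwoPlusNonsquareDescentGrowthComparison
import HarnessLib

/-!
# Non-square descent — ASSEMBLING THE COMPARISON `e_n(M) ≤ e_n(K) + ord₂ #(Q'/ω_nQ') + C` of stub S2 from its four bounds, and feeding it to
# `…GrowthComparison.classicalMuVanishes_of_comparison_with_base` (line `nonsquare-descent`) — seed crux `SignedMuSeedAtTwoPlus`
# stmt-BirchSwinnertonDyer-21438 (parent Kμ⁺ `SignedMuVanishingAtTwoPlus` stmt-BirchSwinnertonDyer-20689, route ResidualThetaTransportAtTwo),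
# line card `Cruxes/SignedMuSeedAtTwoPlus/Lines/nonsquare-descent.md`

Cell `bsd-wall`, width seat `bsd-wall-rtt-p4-w2` g19 (`--supports`, closes nothing).  THEOREMS ONLY; BSD is not proved by this; elementary
arithmetic of `ℕ`-valued sequences and `p`-adic orders.

The four bounds of the S2 chain (by name, this lineage): (a) `e_n(M) = e_n(K) + a_n`, `a_n = ord₂ #A_n^χ` (`…CubicClassGroupSplittingBase.
padicValNat_card_classGroup_eq_base_add`); (b) `a_n ≤ i_n + C₁`, `i_n = ord₂ #B'_n` (index theorem: `Oukhaba2007.thm_index_eq_mul_classNumber_of_isCyclotomic`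
+ `…GrowthComparison.padicValNat_le_of_eq_mul` + `…IsotypicIndex`; arithmetic); (c) `#B'_n ∣ [𝓔_n^χ : 𝒩_n] · #(Q'/ω_nQ')` (g18 `…NormIndexSplit.
natCard_quotient_span_proj_dvd'`), so `i_n ≤ u_n + q_n` in `ord₂` (`padicValNat_le_add_of_dvd_mul` below); (d) `[𝓔_n^χ : 𝒩_n] ≤ K` (`…UnitsModUniversalNorms` /
`…CoherentLimit`), so `u_n ≤ K` (`padicValNat_le_self_of`).  Then:

* `padicValNat_le_add_of_dvd_mul` (`a ∣ b·c`, `b, c ≠ 0 ⟹ ord_p a ≤ ord_p b + ord_p c`), `padicValNat_le_of_le` (`ord_p n ≤ n`, so `u_n ≤ K` from the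
  index bound);
* **`comparison_of_bounds`** — (a)–(d) ⟹ `e_n(M) ≤ e_n(K) + q_n + (C₁ + K)` for `n ≥ n₀`;
* **`classicalMuVanishes_of_bounds`** — the same fed into `classicalMuVanishes_of_comparison_with_base`: with g18's module data on `M = Q'`
  (`(p) ⊆ Jac R`, `T^{N₀}Q' ⊆ pQ'` = «`μ(Q') = 0`», bounded `p`-power torsion, finite layers) and `μ(κ_K) = 0`, the four bounds with
  `q_n = ord_p #(Q'/ω_nQ')` give **`ClassicalMuVanishes κ_M`** — the conclusion of S2 ∧ S3 (∧ S4's GNS through `μ(Q') = 0`) in tree currency.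

[folklore]
-/

set_option autoImplicit false
-- the Theorems namespace of this sub repeats the summit name by design (D-0017 nested layout)
set_option linter.dupNamespace false

open Literature.NumberTheory.IwasawaTheory Literature.NumberTheory.EllipticCurves

namespace Summit.BirchSwinnertonDyer.BirchSwinnertonDyer.Theorems.SignedMuAtTwo.NonsquareDescent

/-! ## §1 `p`-adic orders of the index bounds -/

section Padic

variable {p : ℕ} [hp : Fact p.Prime]

/-- `a ∣ b·c` with `b, c ≠ 0` ⟹ `ord_p a ≤ ord_p b + ord_p c` («`ord₂ #B'_n ≤ ord₂ [𝓔_n^χ : 𝒩_n] + ord₂ #(Q'/ω_nQ')`» from `NormIndexSplit`). [folklore] -/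
theorem padicValNat_le_add_of_dvd_mul {a b c : ℕ} (hb : b ≠ 0) (hc : c ≠ 0) (h : a ∣ b * c) :
    padicValNat p a ≤ padicValNat p b + padicValNat p c := by
  have ha : a ≠ 0 := fun h0 => by
    rw [h0, zero_dvd_iff] at h
    exact mul_ne_zero hb hc h
  rw [← padicValNat.mul hb hc, ← padicValNat_dvd_iff_le (mul_ne_zero hb hc)]
  exact (pow_padicValNat_dvd (p := p) (n := a)).trans h

omit hp in
/-- `ord_p n ≤ n` (so an index bound `[𝓔_n^χ : 𝒩_n] ≤ K` bounds its `ord_p` by `K`). [folklore] -/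
theorem padicValNat_le_of_le {n K : ℕ} (h : n ≤ K) : padicValNat p n ≤ K :=
  ((padicValNat_le_nat_log n).trans (Nat.log_le_self p n)).trans h

end Padic

/-! ## §2 The comparison from the four bounds -/

/-- **`e_n(M) ≤ e_n(K) + q_n + (C₁ + K)`** from (a) `e_n(M) = e_n(K) + a_n`, (b) `a_n ≤ i_n + C₁`, (c) `i_n ≤ u_n + q_n`, (d) `u_n ≤ K` (all for
`n ≥ n₀`). [folklore] -/
theorem comparison_of_bounds {e e' a i u q : ℕ → ℕ} {C₁ K n₀ : ℕ}
    (ha : ∀ n, n₀ ≤ n → e n = e' n + a n) (hb : ∀ n, n₀ ≤ n → a n ≤ i n + C₁)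
    (hc : ∀ n, n₀ ≤ n → i n ≤ u n + q n) (hd : ∀ n, n₀ ≤ n → u n ≤ K) :
    ∀ n, n₀ ≤ n → e n ≤ e' n + q n + (C₁ + K) := by
  intro n hn
  have h1 := ha n hn
  have h2 := hb n hn
  have h3 := hc n hn
  have h4 := hd n hn
  omega

/-! ## §3 `μ(κ_M) = 0` from the four bounds -/

section Mu

variable {p : ℕ} [Fact p.Prime] {K : Type} [Field K] [NumberField K] {K' : Type} [Field K']
  {R : Type*} [CommRing R] {M : Type*} [AddCommGroup M] [Module R M]

/-- **THE S2 CONCLUSION IN TREE CURRENCY: `ClassicalMuVanishes κ`** from g18's module data on `Q'` (`μ(Q') = 0` form), `μ(κ') = 0` for the base tower,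
and the four arithmetic bounds (a)–(d) with `q_n = ord_p #(Q'/ω_nQ')`. [folklore] -/
theorem classicalMuVanishes_of_bounds [Module.Finite R M] (T : R)
    (hjac : Ideal.span {(p : R)} ≤ (⊥ : Ideal R).jacobson) (N₀ : ℕ)
    (hT : Ideal.span {T ^ N₀} • (⊤ : Submodule R M) ≤ Ideal.span {(p : R)} • ⊤)
    (k : ℕ) (htor : ∀ (x : M) (i : ℕ), ((p : R) ^ i) • x = 0 → ((p : R) ^ k) • x = 0)
    (hfin : ∀ n : ℕ, Finite (M ⧸ Ideal.span {(1 + T) ^ (p ^ n) - 1} • (⊤ : Submodule R M)))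
    (κ : ZpExtension K p) (κ' : ZpExtension K' p) (hκ' : ClassicalMuVanishes κ')
    {a i u : ℕ → ℕ} {C₁ Kb n₀ : ℕ}
    (ha : ∀ n, n₀ ≤ n → classNumberPExp κ n = classNumberPExp κ' n + a n)
    (hb : ∀ n, n₀ ≤ n → a n ≤ i n + C₁)
    (hc : ∀ n, n₀ ≤ n → i n ≤ u n + padicValNat p (Nat.card (M ⧸ Ideal.span {(1 + T) ^ (p ^ n) - 1} • (⊤ : Submodule R M))))
    (hd : ∀ n, n₀ ≤ n → u n ≤ Kb) :
    ClassicalMuVanishes κ :=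
  classicalMuVanishes_of_comparison_with_base T hjac N₀ hT k htor hfin κ κ' hκ' (C := C₁ + Kb) (n₃ := n₀)
    (comparison_of_bounds (e := classNumberPExp κ) (e' := classNumberPExp κ')
      (q := fun n => padicValNat p (Nat.card (M ⧸ Ideal.span {(1 + T) ^ (p ^ n) - 1} • (⊤ : Submodule R M)))) ha hb hc hd)

end Mu

end Summit.BirchSwinnertonDyer.BirchSwinnertonDyer.Theorems.SignedMuAtTwo.NonsquareDescent
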